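import Literature.NumberTheory.EllipticCurves.Kobayashi2003.EtaKatoColemanPoitouTateSequences
import Literature.NumberTheory.EllipticCurves.Kim2026.ShaLengthRankZeroLowerBound
import HarnessLib

/-!
# Kim 2026, Thm. 1.11 (1) ⟹ (3): a UNIT Kurihara number gives KATO'S MAIN CONJECTURE (Conj. 1.3,
# "IMC without `p`-adic `L`-functions") for `E/ℚ` at `p ≥ 5` — ANY reduction type, in particular an
# ADDITIVE `p` — read, for the additive partner `W = V ⊗ η` of a good supersingular `a_p = 0` curve `V`,
# on the pinned objects of Kobayashi's `η`-package (named fact; nothing asserted)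

Topic `NumberTheory/EllipticCurves`, sub-directory `Kim2026` (namespace = path,
`Literature.NumberTheory.EllipticCurves.Kim2026`). ONE named fact (`def … : Prop`, D-0014) and nothing
else: no definition with computational content, no instance, no notation, no `_holds` (size XL: Kato's
Euler system and explicit reciprocity law, Mazur–Rubin Kolyvagin systems over `Λ`, Büyükboduk's `Λ`-adic
rigidity, Kobayashi's signed Coleman maps — none of it is in Mathlib). Written for the cell `bsd-potss`
(HOME `run/shared/lean/pub/bsd-potss/`; HUMAN RULING D-0036/D-0074: the programme assembles BSD for analytic
rank ≤ 1 STRICTLY from published theorems and TYPES the remainder — nothing here proves BSD), seat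
`bsd-potss-k8eta-c1` g6, K8 route `QuadraticBranchSignedControl`, crux item stmt-BirchSwinnertonDyer-19601
`PlusEtaLowerInclusion` (Kobayashi's Eisenstein inclusion `Char(X⁺(V/K_∞)^η) ⊆ (L_p⁺(V, η, X))` at the
quadratic `η = ω^{(p−1)/2}` on the `p`-adic-tower-onto good supersingular twists; consumer
`Summits/BirchSwinnertonDyer/BirchSwinnertonDyer/Theorems/QuadraticBranchSignedControlPlusEtaLowerInclusionKuriharaRoad.lean`).

## Why this file (what it adds to the tree's Kim / Kobayashi stories)

The tree types C.-H. Kim's structure theorem in several currencies: Thm. 1.8 (6) as Ш-length bounds in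
analytic rank `0` (`KuriharaNumberKimShaLength`, `Kim2026/ShaLengthRankZero*`), the rank-one clauses, and
Thm. 1.11 in the direction **(3) ⟹ (1)** at a good ORDINARY prime where (3) is a theorem
(`KuriharaNumberKimCertificate`, `KuriharaNumberKimModP`). What no file carries is the direction
**(1) ⟹ (3)** of Thm. 1.11 — «a mod-`p` non-vanishing Kurihara number implies the Iwasawa main conjecture»
(Kato's Conj. 12.10 / Kim's Conj. 1.3, an EQUALITY of characteristic ideals in `Λ` itself, `μ`-part
included) — which is the one direction that is INFORMATIVE at a prime where (3) is open: an additive prime.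
The K8 crux 19601 is exactly such a (3): by the proof of Kobayashi's Thm. 7.4 the Eisenstein inclusion of
the even signed main conjecture at `η` IS the `η`-component of the lower inclusion
`Char 𝐇²(T)^η ⊆ Char(𝐇¹(T)^η/Z(T)^η)` of Kato's main conjecture for `T = T_pV` (Kobayashi §5 p. 10),
i.e. Kato's main conjecture for the ADDITIVE twist `W = V ⊗ η_{p*}` over the cyclotomic `ℤ_p`-extension
— open in print for every non-CM `V`. Thm. 1.11 (1) ⟹ (3) for `E := W` turns it, pair by pair, on the
partners `W` with `p ∤ ∏ c_ℓ(W)`, into a FINITE CERTIFICATE: one Kurihara number `δ̃_n(W) ≢ 0 (mod p)`.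

## The printed statements (C.-H. Kim, *The structure of Selmer groups and the Iwasawa main conjecture
for elliptic curves*, Amer. J. Math. 148 (2026), no. 1, 79–129 = arXiv:2203.12159; held text = the arXiv
version, store key `paper:arxiv-2203.12159`, page files `pNNNN.txt`; journal numbering: arXiv Thm. 1.11 =
journal Thm. 1.10, arXiv Conj. 1.3 = journal Conj. 1.3 — NUMBERING NOTE of `KuriharaNumberKimStructure`;
this file cites the arXiv numbers, as every sibling does)

* §1.2.1–1.2.4 (p0005 L18–L60): "Let `E` be an elliptic curve over `ℚ` of conductor `N` and `p ≥ 5` a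
  prime. Let `T` be the `p`-adic Tate module of `E` … `𝒫_k = {ℓ : (ℓ, Np) = 1, ℓ ≡ 1 (mod p^k),
  a_ℓ(E) ≡ ℓ + 1 (mod p^k)}` and `𝒩_k` the set of square-free products of primes in `𝒫_k` … Let `ℚ_∞` be
  the cyclotomic `ℤ_p`-extension of `ℚ` … `Λ = ℤ_p⟦Gal(ℚ_∞/ℚ)⟧` … the `Λ`-adic Kato's Kolyvagin system
  `κ^{Kato,∞}` … `κ^{Kato,∞}_1 = z^{Kato}_{ℚ_∞} = lim←_m z^{Kato}_{ℚ_m}` … this element lies in the first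
  Iwasawa cohomology group `H¹_Iw(ℚ, T) = lim←_m H¹(ℚ_m, T)`. … Denote by `Sel₀(ℚ_∞, E[p^∞])` the
  `p`-strict ("fine") Selmer group … **Conjecture 1.3 (IMC).** The following equality as (principal)
  ideals of `Λ` holds: `char_Λ(H¹_Iw(ℚ, T)/Λκ^{Kato,∞}_1) = char_Λ(Sel₀(ℚ_∞, E[p^∞])^∨)`."
* §1.3.5 (p0006 L85): "the Manin constant assumption is needed only when `E` has additive reduction at
  `p`." (the additive case is INSIDE the scope of the paper: §3.1, Prop. 3.2 (p0015), Lemma 3.10 treat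
  `E(ℚ_p)[p]` and the dual exponential map at an additive prime explicitly).
* **Theorem 1.11** (p0008 L44–L68), VERBATIM: "Let `E` be an elliptic curve over `ℚ` and `p ≥ 5` a prime
  such that • `ρ̄` is surjective, • the Manin constant is prime to `p`, • `E(ℚ_p)[p] = 0`, and • all the
  Tamagawa factors are prime to `p`. Then the following statements are equivalent. (1) `δ̃^{(1)}_n ≠ 0`
  in `𝔽_p` for some `n ∈ 𝒩₁` with `ν(n) = ord(δ̃^{(1)})`. (2) The mod `p` Kato's Kolyvagin system
  `κ^{Kato,(1)}` is non-trivial. (3) The Iwasawa main conjecture holds. …" — NO hypothesis on the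
  reduction type of `E` at `p`. ("(1) ⟹ (2) ⟹ (3) is the main result of [kks]" = Kim–Kim–Sun; here it
  is re-proved in §6.)
* §6, proof of Thm. 1.11 (p0031 L48–L52), VERBATIM: "If `δ̃^{(1)}_n ≠ 0`, then `κ^{Kato}_n` also does not
  vanish; thus, `κ^{Kato}` is primitive. By the argument in [kazim-Lambda-adic] (see also [kks]), the
  corresponding `Λ`-adic Kato's Kolyvagin system `κ^{Kato,∞}` is `Λ`-primitive. Then the Iwasawa main
  conjecture without `p`-adic `L`-functions follows [mazur-rubin-book]. In other words,
  `char_Λ(H¹_Iw(ℚ, T)/Λ·κ^{Kato,∞}_1) = char_Λ(Sel₀(ℚ_∞, E[p^∞])^∨)`." — with Thm. 6.1 (Büyükboduk: under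
  `ρ̄` onto, `E(ℚ_p)[p] = 0`, Tamagawa factors prime to `p`, `KS(T ⊗ Λ)` is free of rank one and
  `KS(T ⊗ Λ) → KS(T)` is onto) and Remark 6.2 ("Kato's Kolyvagin system cannot be primitive when `p`
  divides Tamagawa factors" — so on such rows NO unit Kurihara number exists and this fact is silent).
  Note on (1): `ord(δ̃^{(1)}) = min{ν(n) : δ̃^{(1)}_n ≠ 0}`, so (1) is equivalent to «`δ̃^{(1)}_n ≠ 0` for
  SOME `n ∈ 𝒩₁`» (a witness of minimal `ν` then exists); the fact below asks for some `n`.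
* S. Kobayashi, Invent. Math. 152 (2003), §5 p. 10 (held copy `paper:doi-10-1007-s00222-002-0265-4`):
  "**Kato's main conjecture.** `Char(𝐇²(T)^η) = Char(𝐇¹(T)^η/Z(T)^η)`" (component by component in
  `η : Δ → ℤ_p^×`, `K_∞ = ℚ(μ_{p^∞})`, `Λ = ℤ_p⟦Δ × Γ⟧`), Thm. 5.2 ("See Kato [7], Theorem 12.5") and the
  proof of Thm. 7.4 (p. 13): the `η`-component of Kato's modules for `T_pV` IS Kato's theory of the twist
  `T_pW = T_pV ⊗ η` over `ℚ_∞` — the reading under which the tree's `η`-package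
  `Kobayashi2003.EtaKatoColemanPoitouTateData p K₀ η V f ϖ κ γ W I FB` (file
  `Kobayashi2003/EtaKatoColemanPoitouTateSequences`) is ALREADY stated on the pinned
  `I : Kato2004.IwasawaH1Data W p κ γ` («`𝐇¹(T_pV)^η = 𝐇¹_Γ(T_pW)`» = Kim's `H¹_Iw(ℚ, T_pW)` along
  `ℚ_∞/ℚ`) and `FB : W.FineSelmerDualData κ γ` («`X⁰(V/K_∞)^η = X⁰(W/ℚ_∞)`» = Kim's `Sel₀(ℚ_∞, W[p^∞])^∨`)
  (flag `Kob03-eta-twist-currency` of that file).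

## The fact below and its reading (weaker than print, never stronger; flags for the referee)

For the `η`-frame of the package fact `Kobayashi2003.thm52_62_63_73_etaKatoColemanPoitouTate` — `p` odd,
`K₀ = ℚ(μ_p)`, `η` THE quadratic character, `V/ℚ` globally minimal good at `p` with `a_p(V) = 0`, newform
`f`, period ratio `ϖ`, cyclotomic `κ` with generator `γ` — and a GLOBALLY MINIMAL partner `W` with
`C • W^{(p*)} = V` satisfying THE FOUR HYPOTHESES OF THM. 1.11 AT `p` typed exactly as in the sibling facts
(`5 ≤ p`; `ρ̄_{W,p}` onto = `HasSurjectiveModNGaloisRep p`; `#W(ℚ_p)[p] = 1` as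
`Nat.card {Q : (W.baseChange ℚ_[p]).toAffine.Point // p • Q = 0} = 1`, the `(t0)` binder of
`Kim2026.rankZero_le_padicValNat_sha_of_kuriharaNumber_ne_zero_of_localTorsionTrivial`; `p ∤ ∏_ℓ c_ℓ(W)`
as `¬ p ∣ W.tamagawaProduct`; Kim's hypothesis (ii) through a modular parametrisation datum
`D : ModularParametrizationData W N` with `¬ p ∣ D.maninConstant` and the period transfer
`Ω(W) = u·Ω⁺_{D.f}`, `|u|_p = 1`, under which `kuriharaNumber D.f p n ψ = ū · δ̃^{(1)}_n` with `ū ∈ 𝔽_pˣ` —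
module docstring of `KuriharaNumberKimCertificate`, "PERIODS") and the CERTIFICATE (1): a level `n ∈ 𝒩₁`
(`Kato.IsKolyvaginProduct W p 1 n`) all of whose primes carry the cyclicity flag `#W̃(𝔽_ℓ)[p] ≤ p` of the
printed Kolyvagin-system argument (Mazur–Rubin transversality; as in EVERY sibling — weaker fact),
surjective discrete logarithms `ψ_ℓ : (ℤ/ℓ)ˣ ↠ ℤ/p` and `kuriharaNumber D.f p n ψ ≠ 0`: THEN for every
pinned `I`, `FB` there is a package datum `d` (Kobayashi Thm. 5.2/6.2/6.3/7.3 i)/Cor. 7.2 at `η`, as the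
package fact asserts) whose zeta line ALSO satisfies the Eisenstein inclusion
`Char_Λ(X⁰) ⊆ Char_Λ(𝐇¹/Λ·z)`, i.e. `Module.charIdeal Λ FB.X ≤ Module.charIdeal Λ (I.H ⧸ Λ∙d.z)` — the
`⊆` half of (3) that Kato's Euler system does not give (its `⊇` half under the onto tower is the
package's own field `kato_integral`, Kobayashi Thm. 5.2 v)). Only this half is recorded (weaker than the
printed equality). READING FLAGS. `Kim26-111-eta-zeta-line` (NEW, the one genuine reading): Kim's (3) is
about the line `Λ·κ^{Kato,∞}_1(W) ⊂ H¹_Iw(ℚ, T_pW) = I.H` of Kato's zeta element of the newform `f_W`; it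
is READ on the line `Λ·z` of a package datum (Kobayashi's «`ε_η z_{η(−1)}`», the `η`-part of Kato's zeta
element of `f_V`, existential in the package); both are norm-compatible Kato zeta classes of the SAME
Galois representation `T_pW = T_pV(η)` along `ℚ_∞`, characterised through the dual exponential / Coleman
maps by the same twisted `L`-values `L(W, χ, 1) = L(V, ηχ, 1)` (Kato Thm. 12.5 (1); Kobayashi Thm. 5.2 i),
Thm. 6.3) up to the period ratio of the twist pair `(Ω_V^{sgn η}·√p*)/Ω_W^±` (a `p`-adic unit: `V` is good
at `p`, Pal) and Gauss-sum units; the identification of the two `Λ`-LINES inside the free rank-one `𝐇¹`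
(Kobayashi Thm. 5.1 iii), Remark 5.3 i)) is NOT formalised, nor is either zeta element a tree object (the
sibling typing note of `Kim2025/MainIdentityAtAugmentationOPEN`: "`Λκ₁^{Kato,∞}` has no name"). Exposure:
a discrepancy between the two lines by a non-unit of `Λ` — excluded by Kato's construction (the zeta
elements of `f ⊗ χ` are the `χ`-parts of those of `f` over `ℚ(μ_{p^∞})`, Kato §§8.1, 12.4–12.5, which is
how Kobayashi's Thm. 5.2 cites Kato's Thm. 12.5 component-wise), not by anything proved here.
`Kim26-111-additive-scope`: Thm. 1.11 is applied to `E := W` ADDITIVE at `p` (`W = V ⊗ η_{p*}`, Kodaira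
I₀*): the theorem carries no reduction hypothesis, §1.3.5 puts the additive case in scope, and the
hypothesis `E(ℚ_p)[p] = 0` is even automatic here (pot. good supersingular reduction acquired over
`ℚ_p(√p*)`, `e = 2 < p − 1`; per row it is certified in the kernel by
`natCard_localPTorsion_eq_one_of_certificate_zmod`). `Kim2026-(6)-cyclic-reading` / cyclicity flag /
period binder: as in the siblings. Everything recorded is implied by, never stronger than, the print under
these readings; the fact is CONDITIONAL DATA for its consumers (hypothesis position), asserts nothing, and
is silent on every partner with `p ∣ ∏ c_ℓ(W)` (Kim Remark 6.2) — in particular it does NOT bear on the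
class-wide crux 19601, only on its Tamagawa-`p`-free pairs one certificate at a time.

What this fact is NOT: not Kim's Conjecture 1.9/1.10 (no claim that a unit Kurihara number exists); not the
converse (3) ⟹ (1) (that is `Kim2022_kuriharaNumber_certificate`, good ordinary); not Kobayashi's even main
conjecture (that is derived Summits-side from this fact + the package by the four-term-sequence algebra of
the proof of Thm. 7.4); not a statement at `p = 3` or for `p ∣ ∏ c_ℓ`.

## References

* C.-H. Kim, Amer. J. Math. 148 (2026) 79–129 = arXiv:2203.12159: Thm. 1.11 (PDF p. 8), Conj. 1.3 and
  §1.2.1–1.2.5 (PDF p. 5), §1.3.5 (PDF p. 6), §1.4.1–1.4.4 (PDF p. 7), Prop. 3.2 (PDF p. 15), §6 with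
  Thm. 6.1, Remark 6.2, Cor. 6.3 and the proof of Thm. 1.11 (PDF p. 31). [Kim2022StructureSelmer]
* S. Kobayashi, Invent. Math. 152 (2003) 1–36: §5 (Kato's main conjecture at `η`, p. 10), Thm. 5.1,
  Thm. 5.2 and Remark 5.3 (pp. 9–10), Thm. 6.3 (p. 11), proof of Thm. 7.4 (p. 13). [Kobayashi2003]
* K. Kato, Astérisque 295 (2004): §12.2, Thm. 12.4, Thm. 12.5, Conj. 12.10 (pp. 220–224). [Kato2004Asterisque]
* B. Mazur, K. Rubin, *Kolyvagin systems*, Mem. AMS 799 (2004), Thm. 5.3.10 (the printed source of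
  "`Λ`-primitive ⟹ IMC"). [MazurRubin2004]
* K. Büyükboduk, *`Λ`-adic Kolyvagin systems*, IMRN 2011 (Kim's Thm. 6.1; background, cited through Kim).
-/

noncomputable section

open scoped Classical

open CongruenceSubgroup Polynomial WeierstrassCurve Field Literature.NumberTheory.EllipticCurves
  Literature.NumberTheory.EllipticCurves.ModularForms Literature.NumberTheory.GaloisRepresentations
  ZpExtension

namespace Literature.NumberTheory.EllipticCurves.Kim2026

/-- **Kim 2026, Thm. 1.11 (1) ⟹ (3) — a unit Kurihara number gives KATO'S MAIN IDENTITY (Kim's (IMC), statement 1.3: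
`char_Λ(H¹_Iw(ℚ,T)/Λκ₁^{Kato,∞}) = char_Λ(Sel₀(ℚ_∞,E[p^∞])^∨)`) for `E/ℚ` at `p ≥ 5`, ANY reduction type —
read for the ADDITIVE partner `W = V ⊗ η_{p*}` of a good supersingular `a_p = 0` curve `V` on the pinned
objects of Kobayashi's `η`-package, as the EISENSTEIN inclusion `Char_Λ(X⁰) ⊆ Char_Λ(𝐇¹/Λz)`** (C.-H. Kim,
Amer. J. Math. 148 (2026) = arXiv:2203.12159, Thm. 1.11 (PDF p. 8) with its proof §6 (PDF p. 31: "If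
`δ̃^{(1)}_n ≠ 0`, then `κ^{Kato}_n` also does not vanish; thus `κ^{Kato}` is primitive … `κ^{Kato,∞}` is
`Λ`-primitive. Then [statement 1.3] without `p`-adic `L`-functions follows"), Conj. 1.3 (PDF
p. 5), §1.3.5; S. Kobayashi, Invent. Math. 152 (2003) §5 p. 10 and proof of Thm. 7.4 p. 13 (Kato's main
identity component-wise in `η`; the `η`-component = Kato's theory of `T_pW` over `ℚ_∞`)). Frame: that of
`Kobayashi2003.thm52_62_63_73_etaKatoColemanPoitouTate` (`p` odd, `K₀ = ℚ(μ_p)`, `η` THE quadratic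
character, `V/ℚ` globally minimal good at `p` with `a_p(V) = 0`, newform `f`, period ratio `ϖ`, cyclotomic
`κ`, generator `γ`), a GLOBALLY MINIMAL partner `W`, `C • W^{(p*)} = V` (instance binder
`ContinuousSMul ℤ_[p] (T_pW)` discharged by `TateModule.continuousSMul_padicInt`), and Thm. 1.11's
hypotheses for `E := W` at `p` typed as in the sibling facts: `5 ≤ p`; `ρ̄_{W,p}` onto; `#W(ℚ_p)[p] = 1`
(`(t0)` binder); `p ∤ ∏_ℓ c_ℓ(W)`; a modular parametrisation datum `D` of `W` with `p ∤ D.maninConstant`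
and the period transfer `Ω(W) = u·Ω⁺_{D.f}`, `|u|_p = 1` (so `kuriharaNumber D.f p n ψ = ū·δ̃^{(1)}_n`,
`ū ∈ 𝔽_pˣ`); the certificate (1): `n ∈ 𝒩₁` (`Kato.IsKolyvaginProduct W p 1 n`) whose primes carry the
cyclicity flag `#W̃(𝔽_ℓ)[p] ≤ p`, surjective `ψ_ℓ : (ℤ/ℓ)ˣ ↠ ℤ/p`, and `kuriharaNumber D.f p n ψ ≠ 0`.
CONCLUSION: for every pinned `I : Kato2004.IwasawaH1Data W p κ γ` («`H¹_Iw(ℚ, T_pW)`») and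
`FB : W.FineSelmerDualData κ γ` («`Sel₀(ℚ_∞, W[p^∞])^∨`») there is a package datum `d` (Kobayashi Thm.
5.2/6.2/6.3/7.3 i)/Cor. 7.2 at `η`) with `Module.charIdeal Λ FB.X ≤ Module.charIdeal Λ (I.H ⧸ Λ∙d.z)` — the
`⊆` half of (3) read on the package's zeta line (the `⊇` half under the onto tower is the package field
`kato_integral`). READING FLAGS (module docstring): `Kim26-111-eta-zeta-line` (Kim's `Λκ₁^{Kato,∞}(W)`
read as the package's `Λ·z`; not formalised), `Kim26-111-additive-scope`, cyclicity flag, period binder.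
Weaker than print, nothing asserted, no `_holds` (size XL); silent when `p ∣ ∏ c_ℓ(W)` (Kim Remark 6.2).
[cite: Kim2022StructureSelmer, Thm. 1.11 (PDF p. 8), proof of Thm. 1.11 in §6 with Thm. 6.1 and Remark 6.2 (PDF p. 31), §1.2.1–1.2.5 (PDF p. 5), §1.3.5 (PDF p. 6), §1.4.1–1.4.3 (PDF p. 7)]
[cite: Kobayashi2003, §5 (p. 10), Thm. 5.1 iii), Thm. 5.2 and Remark 5.3 i) (pp. 9–10), Thm. 6.3 (p. 11), proof of Thm. 7.4 (p. 13)]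
[cite: Kato2004Asterisque, §12.2 (p. 220), Thm. 12.4 and Thm. 12.5 (pp. 221–222), §12.10 (p. 224)]
[cite: MazurRubin2004, Thm. 5.3.10] -/
def thm111_etaEisensteinInclusion_of_kuriharaNumber_ne_zero : Prop :=
  ∀ (p : ℕ) [Fact p.Prime] (K₀ : Type) [Field K₀] [NumberField K₀] [IsCyclotomicExtension {p} ℚ K₀]
    [(galRange (K := ℚ) K₀).Normal] (η : absoluteGaloisGroup ℚ →* ℤˣ),
    (∀ σ ∈ galRange (K := ℚ) K₀, η σ = 1) → η ≠ 1 →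
  ∀ (V : WeierstrassCurve ℚ) [V.IsElliptic] [V.IsGloballyMinimal] {N : ℕ} [NeZero N]
    {f : CuspForm (Gamma0 N) 2},
    p ≠ 2 → V.HasGoodReductionAtPrime p → V.frobeniusTrace p = 0 → IsNewformOf V f →
  ∀ (ϖ : ℚ), (if Even (p / 2) then (ϖ : ℝ) * V.realPeriodRat = plusPeriod f
      else (ϖ : ℝ) * V.imaginaryPeriodRat = minusPeriod f) →
  ∀ (κ : ZpExtension ℚ p) (γ : absoluteGaloisGroup ℚ),
    κ.IsCyclotomic → κ.IsTopGenerator γ → γ ∈ galRange (K := ℚ) K₀ → IsCyclotomicVariable p γ →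
  ∀ (W : WeierstrassCurve ℚ) [W.IsElliptic] [W.IsGloballyMinimal]
    [ContinuousSMul ℤ_[p] (W.tateModule p)]
    (C : VariableChange ℚ), C • W.quadraticTwist ((-1) ^ (p / 2) * p) = V →
  -- the hypotheses of Thm. 1.11 for `E := W` at `p`
    5 ≤ p → W.HasSurjectiveModNGaloisRep p →
    Nat.card {Q : (W.baseChange ℚ_[p]).toAffine.Point // (p : ℕ) • Q = 0} = 1 →
    ¬ p ∣ W.tamagawaProduct →
  ∀ {NW : ℕ} [NeZero NW] (D : ModularParametrizationData W NW),
    ¬ (p : ℤ) ∣ D.maninConstant →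
    (∃ u : ℚ, ‖(u : ℚ_[p])‖ = 1 ∧ W.realPeriodRat = u * plusPeriod D.f) →
  -- the certificate (1): a unit Kurihara number at a level `n ∈ 𝒩₁`
  ∀ (n : ℕ) [NeZero n], Kato.IsKolyvaginProduct W p 1 n →
    (∀ (ℓ : ℕ) [Fact ℓ.Prime], ℓ ∣ n →
      Nat.card {P : ((WeierstrassCurve.integralModelInt W).map
          (Int.castRingHom (ZMod ℓ))).toAffine.Point // p • P = 0} ≤ p) →
  ∀ ψ : (ℓ : ℕ) → (ZMod ℓ)ˣ →* Multiplicative (ZMod p),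
    (∀ ℓ ∈ n.primeFactors, Function.Surjective (ψ ℓ)) →
    kuriharaNumber D.f p n ψ ≠ 0 →
  -- (3), its Eisenstein half, read on the pinned objects of the `η`-package
  ∀ (I : Kato2004.IwasawaH1Data W p κ γ) (FB : W.FineSelmerDualData κ γ),
    ∃ d : Kobayashi2003.EtaKatoColemanPoitouTateData p K₀ η V f ϖ κ γ W I FB,
      Module.charIdeal (IwasawaAlgebra p) FB.X ≤
        Module.charIdeal (IwasawaAlgebra p) (I.H ⧸ Submodule.span (IwasawaAlgebra p) {d.z})

end Literature.NumberTheory.EllipticCurves.Kim2026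

end
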